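import Mathlib
import Summits.Ventures.HodgeRepro2.CanonicalAutomorphyFactor

/-!
# `1 − ‖αz‖² = (1 − ‖z‖²)/|j(α,z)|²` and the Petersson norm of an automorphic form

Kernel annex of the blind cell `pub-hodge-repro2` (seat p2), Tier-3 hypothesis shapes of
`Hypothesis.lean`.  Two classical identities on the ball, in the coordinates of `Hypothesis.lean`:

* `one_sub_normSq_ballAction`: for `α ∈ U(2,1)` and `z` in the ball,
  `1 − ‖αz‖² = (1 − ‖z‖²) / |j(α, z)|²` (invariance of the hermitian form `hermJ21` on the
  homogeneous vectors);
* `petersson`: the Petersson density `|f(z)|² (1 − ‖z‖²)^k` of a function `f` of weight `k`;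
  **`petersson_ballAction`**: it is INVARIANT under every `γ ∈ U(2,1)` for which `f` transforms
  as an automorphic form of weight `k` (`f(γz) = j(γ,z)^k f(z)`, Sh79 §5) — so `|f|²(1 − ‖z‖²)^k`
  is a function on `Γ\𝔹²`, the integrand of the Petersson inner product
  `∫_{Γ\𝔹²} |f|² (1 − ‖z‖²)^{k−3} dV` that the non-vanishing/period statements of the brief are
  about (the volume form `(1 − ‖z‖²)^{−3} dV` is itself invariant: `det_jacobian_eq`).
-/

namespace Summit.Ventures.HodgeRepro2.ShimuraData

/-- The squared Euclidean norm of a point of `ℂ²`, `‖z₀‖² + ‖z₁‖²`. -/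
noncomputable def normSq₂ (z : Fin 2 → ℂ) : ℝ := ‖z 0‖ ^ 2 + ‖z 1‖ ^ 2

/-- `‖z‖² < 1` on the ball. -/
theorem normSq₂_lt_one {z : Fin 2 → ℂ} (hz : z ∈ ball₂) : normSq₂ z < 1 :=
  (mem_ball₂_iff z).1 hz

/-- `1 − ‖z‖² = −hermJ21 (z, 1)`. -/
theorem one_sub_normSq₂ (z : Fin 2 → ℂ) : 1 - normSq₂ z = -hermJ21 (homog z) := by
  rw [hermJ21_homog, normSq₂]
  ring

/-- **The invariance identity** `1 − ‖αz‖² = (1 − ‖z‖²) / |j(α, z)|²` for `α ∈ U(2,1)`, `z ∈ 𝔹²`. -/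
theorem one_sub_normSq₂_ballAction {α : Matrix (Fin 3) (Fin 3) ℂ} (hα : IsInU21 α)
    {z : Fin 2 → ℂ} (hz : z ∈ ball₂) :
    1 - normSq₂ (ballAction α z) = (1 - normSq₂ z) / ‖autFactor α z‖ ^ 2 := by
  have hD := hα.autFactor_ne_zero hz
  have hD' : ‖autFactor α z‖ ^ 2 ≠ 0 := by
    exact pow_ne_zero 2 (norm_ne_zero_iff.2 hD)
  -- `hermJ21 (α·(z,1)) = hermJ21 (z,1)` and `α·(z,1) = j · (αz, 1)`
  have h1 : hermJ21 (α.mulVec (homog z)) = hermJ21 (homog z) := hα.hermJ21_mulVec _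
  rw [mulVec_homog_eq_autFactor_smul hD] at h1
  have h2 : hermJ21 (autFactor α z • homog (ballAction α z)) =
      ‖autFactor α z‖ ^ 2 * hermJ21 (homog (ballAction α z)) := by
    simp only [hermJ21, Pi.smul_apply, smul_eq_mul, norm_mul, mul_pow]
    ring
  rw [h2] at h1
  rw [one_sub_normSq₂, one_sub_normSq₂, eq_div_iff hD', ← h1]
  ring

/-- The Petersson density of weight `k`: `|f(z)|² · (1 − ‖z‖²)^k`. -/
noncomputable def petersson (k : ℕ) (f : (Fin 2 → ℂ) → ℂ) (z : Fin 2 → ℂ) : ℝ :=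
  ‖f z‖ ^ 2 * (1 - normSq₂ z) ^ k

/-- **The Petersson density of a weight-`k` automorphic form is invariant**: if
`f(γz) = j(γ, z)^k f(z)` for `γ ∈ U(2,1)` and `z` in the ball, then
`|f(γz)|² (1 − ‖γz‖²)^k = |f(z)|² (1 − ‖z‖²)^k`. -/
theorem petersson_ballAction {k : ℕ} {f : (Fin 2 → ℂ) → ℂ} {γ : Matrix (Fin 3) (Fin 3) ℂ}
    (hγU : IsInU21 γ) {z : Fin 2 → ℂ} (hz : z ∈ ball₂)
    (hf : f (ballAction γ z) = autFactor γ z ^ k * f z) :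
    petersson k f (ballAction γ z) = petersson k f z := by
  have hD := hγU.autFactor_ne_zero hz
  have hD' : ‖autFactor γ z‖ ^ 2 ≠ 0 := pow_ne_zero 2 (norm_ne_zero_iff.2 hD)
  rw [petersson, petersson, hf, one_sub_normSq₂_ballAction hγU hz, norm_mul, norm_pow,
    mul_pow, div_pow, ← pow_mul, ← pow_mul, mul_comm 2 k]
  field_simp

/-- The Petersson density of a weight-`k` automorphic form for the image of `Γ ⊆ Γ_N` descends
to `Γ\𝔹²` (invariance under every `γ ∈ Γ`, through the frame). -/
theorem petersson_ballAction_realEmbedding {K : Type*} [Field K] [NumberField K]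
    [NumberField.IsCMField K] {τ₁ : K →+* ℂ} {H : Matrix (Fin 3) (Fin 3) K}
    {Q : Matrix (Fin 3) (Fin 3) ℂ} (hQ : IsFrame K τ₁ H Q) {k : ℕ} {f : (Fin 2 → ℂ) → ℂ}
    {γ : GL (Fin 3) K} (hγ : γ ∈ unitaryGroup K H) {z : Fin 2 → ℂ} (hz : z ∈ ball₂)
    (hf : f (ballAction (realEmbedding K τ₁ Q γ) z) = autFactor (realEmbedding K τ₁ Q γ) z ^ k * f z) :
    petersson k f (ballAction (realEmbedding K τ₁ Q γ) z) = petersson k f z :=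
  petersson_ballAction (hQ.isInU21_realEmbedding hγ) hz hf

end Summit.Ventures.HodgeRepro2.ShimuraData
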